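import Summits.QuantumFields.BalabanUV.InfraRed.StrongCouplingFluxField
import HarnessLib

/-!
# Strong-coupling front, J-SC16k (part 1/3): the ball moments of the flux test field — the expansions `H`, `Q` —
observatory of the non-perturbative crossover; no mass-gap claim

IR-3 v2 TWO-FRONT CROSSOVER LEDGER, front SC (`β₀`), SU(2), `d = 4`, Wilson normalisation `β_W = 4/g²`.
ABSOLUTE RULE of this package: No internally-minted statement may enter as a cited fact. Every hypothesis is either
kernel-proved in this package or a verbatim quotation of a PUBLISHED theorem with page reference. The manuscript(s)
under audit are NOT citable for their own disputed steps — they are the thing under adjudication; programme-internal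
(2001/route/tribunal) claims are never citable.  Nothing is cited here: every statement below is [folklore] calculus,
kernel-proved.

## What this file is

Leaf (20) of the kernel port of FRONT-SC §3n (the oblique half of the tree's typed open node
`StrongCouplingQuarterCovariance.QuarterCovariance`).  For the flux test field `W(y) = e^{κ y₀}(e + (α y₀ + β) y)` of
leaf (19) (`StrongCouplingFluxField`), the flux side of J-SC16f's `abs_integral_lipschitz_mul_inner_le` is a finite
combination of the BALL MOMENTS `∫₀¹ r^a ∫ (x₀)^k e^{κ r x₀} dσ dr` that leaves (16)–(18) bracket
(`Z, Z′, z_B, m₂, J41, J52, J61, J72, J63, J74`).  This file is the bookkeeping that expands the two quadratic quantities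
of the λ-method (leaf (21)) into those moments:
* plumbing — continuity of parametric Haar integrals on the compact group (`continuous_integral₂`), finite linearity of
  the Haar integral and of the radial integral (`integral_lin5`, `intervalIntegral_lin8`), and the master expansion
  `integral_poly` of `∫₀¹ r³ ∫ e^{κ r x₀} · P(r, x₀) dσ dr` for the eight-term family `P` that occurs;
* `H_expand`:  `∫₀¹ r³ ∫ e^{κ r x₀} (c₀ + c₁ r x₀ + c₂ (r x₀)²)² dσ dr
      = c₀² z_B + 2 c₀ c₁ J41 + (c₁² + 2 c₀ c₂) J52 + 2 c₁ c₂ J63 + c₂² J74`;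
* `norm_sq_affine`, `Q_expand`:  for `Re d′ = 0`,
  `∫₀¹ r³ ∫ e^{κ r x₀} ‖(d′ + q) + (α r x₀ + β)(r x)‖² dσ dr = (‖d′‖² + q²) z_B + 2qβ J41 + 2qα J52 + β² m₂ + 2αβ J61 + α² J72`
  — the cross term `⟪d′, x⟫` integrates to zero by leaf (19)'s reflection symmetry `integral_inner_mul_eq_zero`;
* `ball_integral_nonneg`.
Leaf (21) (`StrongCouplingFluxLambda`) evaluates the flux side as `|p|·Y + X` and bounds `Y`, `X` through `H`, `Q`;
leaf (22) (`StrongCouplingFluxCovariance`) proves `QuarterCovariance`.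

NOT CLAIMED: any inequality with content, any number; no mass-gap claim.
-/

noncomputable section

open MeasureTheory Filter Finset Real
open scoped NNReal Quaternion Matrix ComplexConjugate BigOperators Matrix.Norms.Frobenius ContDiff Topology
  RealInnerProductSpace

open Matrix Complex
open Literature.MathematicalPhysics.QuantumLattice (su2Quat quatMatrix quatMatrix_mul quatMatrix_su2Quat norm_su2Quat)
open Literature.MathematicalPhysics.QuantumFieldTheory
open Literature.MathematicalPhysics.QuantumFieldTheory.SUNBakryEmery
open Literature.MathematicalPhysics.QuantumFieldTheory.Balaban1983to89.StrongCouplingVarianceWindow (qI qJ qK)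

namespace Summit.QuantumFields.BalabanUV.InfraRed.StrongCouplingFluxMoments

open Summit.QuantumFields.BalabanUV.InfraRed.StrongCouplingSphereCalculus (radialDiv quatOfMat quatOfMat_coe)
open Summit.QuantumFields.BalabanUV.InfraRed.StrongCouplingFluxField

/-! ## 0. Continuity and linearity plumbing on `SU(2)` -/

/-- Continuity of `su2Quat`. [folklore] -/
private theorem cq1 : Continuous fun g : Matrix.specialUnitaryGroup (Fin 2) ℂ => su2Quat g := by
  have h : Continuous fun g : Matrix.specialUnitaryGroup (Fin 2) ℂ => quatOfMat (g : Matrix (Fin 2) (Fin 2) ℂ) :=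
    (LinearMap.continuous_of_finiteDimensional quatOfMat).comp continuous_subtype_val
  simpa only [quatOfMat_coe] using h

/-- Continuity of the coordinate `x₀`. [folklore] -/
private theorem cq2 : Continuous fun g : Matrix.specialUnitaryGroup (Fin 2) ℂ => (su2Quat g).re :=
  Quaternion.continuous_re.comp cq1

/-- Joint continuity plumbing: `(r, g) ↦ x_g`. [folklore] -/
private theorem cp1 : Continuous fun p : ℝ × Matrix.specialUnitaryGroup (Fin 2) ℂ => su2Quat p.2 :=
  cq1.comp continuous_snd

/-- Joint continuity plumbing: `(r, g) ↦ (x_g)₀`. [folklore] -/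
private theorem cp2 : Continuous fun p : ℝ × Matrix.specialUnitaryGroup (Fin 2) ℂ => (su2Quat p.2).re :=
  cq2.comp continuous_snd

/-- A jointly continuous integrand has a continuous Haar integral (compactness of `SU(2)`). [folklore] -/
theorem continuous_integral₂ {F : ℝ → Matrix.specialUnitaryGroup (Fin 2) ℂ → ℝ}
    (hF : Continuous fun p : ℝ × Matrix.specialUnitaryGroup (Fin 2) ℂ => F p.1 p.2) :
    Continuous fun r : ℝ => ∫ g, F r g ∂haarProbability (Matrix.specialUnitaryGroup (Fin 2) ℂ) := by
  have h := continuous_parametric_integral_of_continuous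
    (μ := haarProbability (Matrix.specialUnitaryGroup (Fin 2) ℂ)) hF isCompact_univ
  simpa only [Measure.restrict_univ] using h

/-- Linearity of the Haar integral over five continuous integrands (bookkeeping). [folklore] -/
theorem integral_lin5 {f₀ f₁ f₂ f₃ f₄ : Matrix.specialUnitaryGroup (Fin 2) ℂ → ℝ} (h₀ : Continuous f₀)
    (h₁ : Continuous f₁) (h₂ : Continuous f₂) (h₃ : Continuous f₃) (h₄ : Continuous f₄) (c₀ c₁ c₂ c₃ c₄ : ℝ) :
    ∫ g, (c₀ * f₀ g + c₁ * f₁ g + c₂ * f₂ g + c₃ * f₃ g + c₄ * f₄ g) ∂haarProbability (Matrix.specialUnitaryGroup (Fin 2) ℂ) =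
      c₀ * ∫ g, f₀ g ∂haarProbability (Matrix.specialUnitaryGroup (Fin 2) ℂ) +
      c₁ * ∫ g, f₁ g ∂haarProbability (Matrix.specialUnitaryGroup (Fin 2) ℂ) +
      c₂ * ∫ g, f₂ g ∂haarProbability (Matrix.specialUnitaryGroup (Fin 2) ℂ) +
      c₃ * ∫ g, f₃ g ∂haarProbability (Matrix.specialUnitaryGroup (Fin 2) ℂ) +
      c₄ * ∫ g, f₄ g ∂haarProbability (Matrix.specialUnitaryGroup (Fin 2) ℂ) := by
  have i₀ := (integrable_of_continuous_SUN h₀ (haarProbability (Matrix.specialUnitaryGroup (Fin 2) ℂ))).const_mul c₀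
  have i₁ := (integrable_of_continuous_SUN h₁ (haarProbability (Matrix.specialUnitaryGroup (Fin 2) ℂ))).const_mul c₁
  have i₂ := (integrable_of_continuous_SUN h₂ (haarProbability (Matrix.specialUnitaryGroup (Fin 2) ℂ))).const_mul c₂
  have i₃ := (integrable_of_continuous_SUN h₃ (haarProbability (Matrix.specialUnitaryGroup (Fin 2) ℂ))).const_mul c₃
  have i₄ := (integrable_of_continuous_SUN h₄ (haarProbability (Matrix.specialUnitaryGroup (Fin 2) ℂ))).const_mul c₄
  have s₁ : Integrable (fun g => c₀ * f₀ g + c₁ * f₁ g) (haarProbability (Matrix.specialUnitaryGroup (Fin 2) ℂ)) := i₀.add i₁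
  have s₂ : Integrable (fun g => c₀ * f₀ g + c₁ * f₁ g + c₂ * f₂ g)
      (haarProbability (Matrix.specialUnitaryGroup (Fin 2) ℂ)) := s₁.add i₂
  have s₃ : Integrable (fun g => c₀ * f₀ g + c₁ * f₁ g + c₂ * f₂ g + c₃ * f₃ g)
      (haarProbability (Matrix.specialUnitaryGroup (Fin 2) ℂ)) := s₂.add i₃
  rw [integral_add s₃ i₄, integral_add s₂ i₃, integral_add s₁ i₂, integral_add i₀ i₁]
  simp only [integral_const_mul]

/-- Linearity of `∫₀¹` over eight continuous integrands (bookkeeping). [folklore] -/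
theorem intervalIntegral_lin8 {u₀ u₁ u₂ u₃ u₄ u₅ u₆ u₇ : ℝ → ℝ} (h₀ : Continuous u₀) (h₁ : Continuous u₁)
    (h₂ : Continuous u₂) (h₃ : Continuous u₃) (h₄ : Continuous u₄) (h₅ : Continuous u₅) (h₆ : Continuous u₆)
    (h₇ : Continuous u₇) (c₀ c₁ c₂ c₃ c₄ c₅ c₆ c₇ : ℝ) :
    ∫ r in (0:ℝ)..1, (c₀ * u₀ r + c₁ * u₁ r + c₂ * u₂ r + c₃ * u₃ r + c₄ * u₄ r + c₅ * u₅ r + c₆ * u₆ r + c₇ * u₇ r) =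
      c₀ * (∫ r in (0:ℝ)..1, u₀ r) + c₁ * (∫ r in (0:ℝ)..1, u₁ r) + c₂ * (∫ r in (0:ℝ)..1, u₂ r) +
      c₃ * (∫ r in (0:ℝ)..1, u₃ r) + c₄ * (∫ r in (0:ℝ)..1, u₄ r) + c₅ * (∫ r in (0:ℝ)..1, u₅ r) +
      c₆ * (∫ r in (0:ℝ)..1, u₆ r) + c₇ * (∫ r in (0:ℝ)..1, u₇ r) := by
  have i₀ := (h₀.intervalIntegrable 0 1 (μ := volume)).const_mul c₀
  have i₁ := (h₁.intervalIntegrable 0 1 (μ := volume)).const_mul c₁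
  have i₂ := (h₂.intervalIntegrable 0 1 (μ := volume)).const_mul c₂
  have i₃ := (h₃.intervalIntegrable 0 1 (μ := volume)).const_mul c₃
  have i₄ := (h₄.intervalIntegrable 0 1 (μ := volume)).const_mul c₄
  have i₅ := (h₅.intervalIntegrable 0 1 (μ := volume)).const_mul c₅
  have i₆ := (h₆.intervalIntegrable 0 1 (μ := volume)).const_mul c₆
  have i₇ := (h₇.intervalIntegrable 0 1 (μ := volume)).const_mul c₇
  have s₁ : IntervalIntegrable (fun r => c₀ * u₀ r + c₁ * u₁ r) volume 0 1 := i₀.add i₁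
  have s₂ : IntervalIntegrable (fun r => c₀ * u₀ r + c₁ * u₁ r + c₂ * u₂ r) volume 0 1 := s₁.add i₂
  have s₃ : IntervalIntegrable (fun r => c₀ * u₀ r + c₁ * u₁ r + c₂ * u₂ r + c₃ * u₃ r) volume 0 1 := s₂.add i₃
  have s₄ : IntervalIntegrable (fun r => c₀ * u₀ r + c₁ * u₁ r + c₂ * u₂ r + c₃ * u₃ r + c₄ * u₄ r) volume 0 1 :=
    s₃.add i₄
  have s₅ : IntervalIntegrable (fun r => c₀ * u₀ r + c₁ * u₁ r + c₂ * u₂ r + c₃ * u₃ r + c₄ * u₄ r + c₅ * u₅ r)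
      volume 0 1 := s₄.add i₅
  have s₆ : IntervalIntegrable
      (fun r => c₀ * u₀ r + c₁ * u₁ r + c₂ * u₂ r + c₃ * u₃ r + c₄ * u₄ r + c₅ * u₅ r + c₆ * u₆ r) volume 0 1 := s₅.add i₆
  rw [intervalIntegral.integral_add s₆ i₇, intervalIntegral.integral_add s₅ i₆, intervalIntegral.integral_add s₄ i₅,
    intervalIntegral.integral_add s₃ i₄, intervalIntegral.integral_add s₂ i₃, intervalIntegral.integral_add s₁ i₂,
    intervalIntegral.integral_add i₀ i₁]
  simp only [intervalIntegral.integral_const_mul]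

/-! ## 1. Expansion of polynomial ball moments into the `J(a, k)` of the ball certificate -/

/-- **Expansion lemma.**  With `x₀ = Re x_g`, for all real coefficients,
`∫₀¹ r³ ∫ e^{κ r x₀} (A₀ + A₁ (rx₀) + A₂ (rx₀)² + A₃ (rx₀)³ + A₄ (rx₀)⁴ + B₀ r² + B₁ r³x₀ + B₂ r⁴x₀²) dσ dr
 = A₀ z_B + A₁ J41 + A₂ J52 + A₃ J63 + A₄ J74 + B₀ m₂ + B₁ J61 + B₂ J72`
in the defining forms of J-SC16i (`J(a,k) = ∫₀¹ rᵃ ∫ x₀ᵏ e^{κ r x₀} dσ dr`). [folklore] -/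
theorem integral_poly (κ A₀ A₁ A₂ A₃ A₄ B₀ B₁ B₂ : ℝ) : ∫ r in (0:ℝ)..1, r ^ 3 * ∫ g, Real.exp (κ * r * (su2Quat g).re) *
        (A₀ + A₁ * (r * (su2Quat g).re) + A₂ * (r * (su2Quat g).re) ^ 2 + A₃ * (r * (su2Quat g).re) ^ 3 +
          A₄ * (r * (su2Quat g).re) ^ 4 + B₀ * r ^ 2 + B₁ * (r ^ 3 * (su2Quat g).re) + B₂ * (r ^ 4 * (su2Quat g).re ^ 2))
        ∂haarProbability (Matrix.specialUnitaryGroup (Fin 2) ℂ) =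
      A₀ * (∫ r in (0:ℝ)..1, r ^ 3 * ∫ g, Real.exp (κ * r * (su2Quat g).re) ∂haarProbability (Matrix.specialUnitaryGroup (Fin 2) ℂ)) +
      A₁ * (∫ r in (0:ℝ)..1, r ^ 4 * ∫ g, (su2Quat g).re * Real.exp (κ * r * (su2Quat g).re) ∂haarProbability (Matrix.specialUnitaryGroup (Fin 2) ℂ)) +
      A₂ * (∫ r in (0:ℝ)..1, r ^ 5 * ∫ g, (su2Quat g).re ^ 2 * Real.exp (κ * r * (su2Quat g).re) ∂haarProbability (Matrix.specialUnitaryGroup (Fin 2) ℂ)) +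
      A₃ * (∫ r in (0:ℝ)..1, r ^ 6 * ∫ g, (su2Quat g).re ^ 3 * Real.exp (κ * r * (su2Quat g).re) ∂haarProbability (Matrix.specialUnitaryGroup (Fin 2) ℂ)) +
      A₄ * (∫ r in (0:ℝ)..1, r ^ 7 * ∫ g, (su2Quat g).re ^ 4 * Real.exp (κ * r * (su2Quat g).re) ∂haarProbability (Matrix.specialUnitaryGroup (Fin 2) ℂ)) +
      B₀ * (∫ r in (0:ℝ)..1, r ^ 5 * ∫ g, Real.exp (κ * r * (su2Quat g).re) ∂haarProbability (Matrix.specialUnitaryGroup (Fin 2) ℂ)) +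
      B₁ * (∫ r in (0:ℝ)..1, r ^ 6 * ∫ g, (su2Quat g).re * Real.exp (κ * r * (su2Quat g).re) ∂haarProbability (Matrix.specialUnitaryGroup (Fin 2) ℂ)) +
      B₂ * (∫ r in (0:ℝ)..1, r ^ 7 * ∫ g, (su2Quat g).re ^ 2 * Real.exp (κ * r * (su2Quat g).re) ∂haarProbability (Matrix.specialUnitaryGroup (Fin 2) ℂ)) := by
  have hq := cq2
  have hp := cp2
  -- the inner integral, for each `r`
  have inner : ∀ r : ℝ, ∫ g, Real.exp (κ * r * (su2Quat g).re) *
        (A₀ + A₁ * (r * (su2Quat g).re) + A₂ * (r * (su2Quat g).re) ^ 2 + A₃ * (r * (su2Quat g).re) ^ 3 +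
          A₄ * (r * (su2Quat g).re) ^ 4 + B₀ * r ^ 2 + B₁ * (r ^ 3 * (su2Quat g).re) + B₂ * (r ^ 4 * (su2Quat g).re ^ 2))
        ∂haarProbability (Matrix.specialUnitaryGroup (Fin 2) ℂ) =
      (A₀ + B₀ * r ^ 2) * ∫ g, Real.exp (κ * r * (su2Quat g).re)
          ∂haarProbability (Matrix.specialUnitaryGroup (Fin 2) ℂ) +
      (A₁ * r + B₁ * r ^ 3) * ∫ g, (su2Quat g).re * Real.exp (κ * r * (su2Quat g).re)
          ∂haarProbability (Matrix.specialUnitaryGroup (Fin 2) ℂ) +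
      (A₂ * r ^ 2 + B₂ * r ^ 4) * ∫ g, (su2Quat g).re ^ 2 * Real.exp (κ * r * (su2Quat g).re) ∂haarProbability (Matrix.specialUnitaryGroup (Fin 2) ℂ) +
      (A₃ * r ^ 3) * ∫ g, (su2Quat g).re ^ 3 * Real.exp (κ * r * (su2Quat g).re) ∂haarProbability (Matrix.specialUnitaryGroup (Fin 2) ℂ) +
      (A₄ * r ^ 4) * ∫ g, (su2Quat g).re ^ 4 * Real.exp (κ * r * (su2Quat g).re) ∂haarProbability (Matrix.specialUnitaryGroup (Fin 2) ℂ) := by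
    intro r
    rw [← integral_lin5 (by fun_prop) (by fun_prop) (by fun_prop) (by fun_prop) (by fun_prop)]
    refine integral_congr_ae (ae_of_all _ fun g => ?_)
    ring
  have outer : ∀ r : ℝ, r ^ 3 * ∫ g, Real.exp (κ * r * (su2Quat g).re) *
        (A₀ + A₁ * (r * (su2Quat g).re) + A₂ * (r * (su2Quat g).re) ^ 2 + A₃ * (r * (su2Quat g).re) ^ 3 +
          A₄ * (r * (su2Quat g).re) ^ 4 + B₀ * r ^ 2 + B₁ * (r ^ 3 * (su2Quat g).re) + B₂ * (r ^ 4 * (su2Quat g).re ^ 2))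
        ∂haarProbability (Matrix.specialUnitaryGroup (Fin 2) ℂ) =
      A₀ * (r ^ 3 * ∫ g, Real.exp (κ * r * (su2Quat g).re)
          ∂haarProbability (Matrix.specialUnitaryGroup (Fin 2) ℂ)) +
      A₁ * (r ^ 4 * ∫ g, (su2Quat g).re * Real.exp (κ * r * (su2Quat g).re)
          ∂haarProbability (Matrix.specialUnitaryGroup (Fin 2) ℂ)) +
      A₂ * (r ^ 5 * ∫ g, (su2Quat g).re ^ 2 * Real.exp (κ * r * (su2Quat g).re) ∂haarProbability (Matrix.specialUnitaryGroup (Fin 2) ℂ)) +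
      A₃ * (r ^ 6 * ∫ g, (su2Quat g).re ^ 3 * Real.exp (κ * r * (su2Quat g).re) ∂haarProbability (Matrix.specialUnitaryGroup (Fin 2) ℂ)) +
      A₄ * (r ^ 7 * ∫ g, (su2Quat g).re ^ 4 * Real.exp (κ * r * (su2Quat g).re) ∂haarProbability (Matrix.specialUnitaryGroup (Fin 2) ℂ)) +
      B₀ * (r ^ 5 * ∫ g, Real.exp (κ * r * (su2Quat g).re)
          ∂haarProbability (Matrix.specialUnitaryGroup (Fin 2) ℂ)) +
      B₁ * (r ^ 6 * ∫ g, (su2Quat g).re * Real.exp (κ * r * (su2Quat g).re)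
          ∂haarProbability (Matrix.specialUnitaryGroup (Fin 2) ℂ)) +
      B₂ * (r ^ 7 * ∫ g, (su2Quat g).re ^ 2 * Real.exp (κ * r * (su2Quat g).re) ∂haarProbability (Matrix.specialUnitaryGroup (Fin 2) ℂ)) := by
    intro r; rw [inner r]; ring
  rw [intervalIntegral.integral_congr (fun r _ => outer r)]
  have c0 := continuous_integral₂ (F := fun r g => Real.exp (κ * r * (su2Quat g).re)) (by fun_prop)
  have c1 := continuous_integral₂ (F := fun r g => (su2Quat g).re * Real.exp (κ * r * (su2Quat g).re)) (by fun_prop)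
  have c2 := continuous_integral₂ (F := fun r g => (su2Quat g).re ^ 2 * Real.exp (κ * r * (su2Quat g).re)) (by fun_prop)
  have c3 := continuous_integral₂ (F := fun r g => (su2Quat g).re ^ 3 * Real.exp (κ * r * (su2Quat g).re)) (by fun_prop)
  have c4 := continuous_integral₂ (F := fun r g => (su2Quat g).re ^ 4 * Real.exp (κ * r * (su2Quat g).re)) (by fun_prop)
  exact intervalIntegral_lin8 ((continuous_pow 3).mul c0) ((continuous_pow 4).mul c1) ((continuous_pow 5).mul c2)
    ((continuous_pow 6).mul c3) ((continuous_pow 7).mul c4) ((continuous_pow 5).mul c0) ((continuous_pow 6).mul c1)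
    ((continuous_pow 7).mul c2) A₀ A₁ A₂ A₃ A₄ B₀ B₁ B₂


/-! ## 2. Expansions of `H` and `Q` into the ball moments (the transverse cross term dies) -/

/-- **Expansion of `H`** into the ball moments of J-SC16i. [folklore] -/
theorem H_expand (κ c₀ c₁ c₂ : ℝ) : ∫ r in (0:ℝ)..1, r ^ 3 * ∫ g, Real.exp (κ * r * (su2Quat g).re) *
        (c₀ + c₁ * (r * (su2Quat g).re) + c₂ * (r * (su2Quat g).re) ^ 2) ^ 2 ∂haarProbability (Matrix.specialUnitaryGroup (Fin 2) ℂ) =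
      c₀ ^ 2 * (∫ r in (0:ℝ)..1, r ^ 3 * ∫ g, Real.exp (κ * r * (su2Quat g).re) ∂haarProbability (Matrix.specialUnitaryGroup (Fin 2) ℂ)) +
      2 * c₀ * c₁ * (∫ r in (0:ℝ)..1, r ^ 4 * ∫ g, (su2Quat g).re * Real.exp (κ * r * (su2Quat g).re) ∂haarProbability (Matrix.specialUnitaryGroup (Fin 2) ℂ)) +
      (c₁ ^ 2 + 2 * c₀ * c₂) * (∫ r in (0:ℝ)..1, r ^ 5 * ∫ g,
          (su2Quat g).re ^ 2 * Real.exp (κ * r * (su2Quat g).re) ∂haarProbability (Matrix.specialUnitaryGroup (Fin 2) ℂ)) +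
      2 * c₁ * c₂ * (∫ r in (0:ℝ)..1, r ^ 6 * ∫ g, (su2Quat g).re ^ 3 * Real.exp (κ * r * (su2Quat g).re) ∂haarProbability (Matrix.specialUnitaryGroup (Fin 2) ℂ)) +
      c₂ ^ 2 * (∫ r in (0:ℝ)..1, r ^ 7 * ∫ g, (su2Quat g).re ^ 4 * Real.exp (κ * r * (su2Quat g).re) ∂haarProbability (Matrix.specialUnitaryGroup (Fin 2) ℂ)) := by
  have h := integral_poly κ (c₀ ^ 2) (2 * c₀ * c₁) (c₁ ^ 2 + 2 * c₀ * c₂) (2 * c₁ * c₂) (c₂ ^ 2) 0 0 0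
  simp only [zero_mul, add_zero] at h
  rw [← h]
  refine intervalIntegral.integral_congr fun r _ => ?_
  congr 1
  refine integral_congr_ae (ae_of_all _ fun g => ?_)
  ring

/-- On the unit sphere: `‖d' + q + s·x‖² = ‖d'‖² + q² + 2qs x₀ + s² + 2s⟪d', x⟫` for `Re d' = 0`, `q s : ℝ`.
[folklore] -/
theorem norm_sq_affine (d' : ℍ) (hd' : d'.re = 0) (q s : ℝ) (x : ℍ) (hx : ‖x‖ = 1) :
    ‖d' + (q : ℍ) + s • x‖ ^ 2 = ‖d'‖ ^ 2 + q ^ 2 + 2 * q * s * x.re + s ^ 2 + 2 * s * ⟪d', x⟫ := by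
  have h1 : ⟪d', (q : ℍ)⟫ = 0 := by
    rw [Quaternion.inner_def, Quaternion.star_coe, Quaternion.re_mul]; simp [hd']
  have h2 : ⟪(q : ℍ), x⟫ = q * x.re := by
    rw [Quaternion.inner_def, Quaternion.re_mul]; simp
  have h3 : ‖(q : ℍ)‖ ^ 2 = q ^ 2 := by rw [Quaternion.norm_coe, Real.norm_eq_abs, sq_abs]
  rw [norm_add_sq_real, norm_add_sq_real, norm_smul, hx, mul_one, Real.norm_eq_abs, sq_abs, inner_add_left,
    real_inner_smul_right, real_inner_smul_right, h1, h2, h3]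
  ring

/-- **Expansion of `Q`** for `e = d' + q` with `Re d' = 0`: the `⟪d', x⟫`-term dies by the reflection symmetry
(`integral_inner_mul_eq_zero` of J-SC16j) and the rest is polynomial in `(r, x₀)`:
`Q = (‖d'‖² + q²) z_B + 2qβ J41 + 2qα J52 + β² m₂ + 2αβ J61 + α² J72`. [folklore] -/
theorem Q_expand (κ α β q : ℝ) {d' : ℍ} (hd' : d'.re = 0) : ∫ r in (0:ℝ)..1, r ^ 3 * ∫ g, Real.exp (κ * r * (su2Quat g).re) *
        ‖(d' + (q : ℍ)) + (α * (r * (su2Quat g).re) + β) • (r • su2Quat g)‖ ^ 2 ∂haarProbability (Matrix.specialUnitaryGroup (Fin 2) ℂ) =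
      (‖d'‖ ^ 2 + q ^ 2) * (∫ r in (0:ℝ)..1, r ^ 3 * ∫ g, Real.exp (κ * r * (su2Quat g).re) ∂haarProbability (Matrix.specialUnitaryGroup (Fin 2) ℂ)) +
      2 * q * β * (∫ r in (0:ℝ)..1, r ^ 4 * ∫ g, (su2Quat g).re * Real.exp (κ * r * (su2Quat g).re) ∂haarProbability (Matrix.specialUnitaryGroup (Fin 2) ℂ)) +
      2 * q * α * (∫ r in (0:ℝ)..1, r ^ 5 * ∫ g, (su2Quat g).re ^ 2 * Real.exp (κ * r * (su2Quat g).re) ∂haarProbability (Matrix.specialUnitaryGroup (Fin 2) ℂ)) +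
      β ^ 2 * (∫ r in (0:ℝ)..1, r ^ 5 * ∫ g, Real.exp (κ * r * (su2Quat g).re) ∂haarProbability (Matrix.specialUnitaryGroup (Fin 2) ℂ)) +
      2 * α * β * (∫ r in (0:ℝ)..1, r ^ 6 * ∫ g, (su2Quat g).re * Real.exp (κ * r * (su2Quat g).re) ∂haarProbability (Matrix.specialUnitaryGroup (Fin 2) ℂ)) +
      α ^ 2 * (∫ r in (0:ℝ)..1, r ^ 7 * ∫ g, (su2Quat g).re ^ 2 * Real.exp (κ * r * (su2Quat g).re) ∂haarProbability (Matrix.specialUnitaryGroup (Fin 2) ℂ)) := by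
  have hq1 := cq1
  have hq := cq2
  have h := integral_poly κ (‖d'‖ ^ 2 + q ^ 2) (2 * q * β) (2 * q * α) 0 0 (β ^ 2) (2 * α * β) (α ^ 2)
  simp only [zero_mul, add_zero] at h
  have inner : ∀ r : ℝ, ∫ g, Real.exp (κ * r * (su2Quat g).re) *
        ‖(d' + (q : ℍ)) + (α * (r * (su2Quat g).re) + β) • (r • su2Quat g)‖ ^ 2 ∂haarProbability (Matrix.specialUnitaryGroup (Fin 2) ℂ) =
      ∫ g, Real.exp (κ * r * (su2Quat g).re) * ((‖d'‖ ^ 2 + q ^ 2) + 2 * q * β * (r * (su2Quat g).re) + 2 * q * α * (r * (su2Quat g).re) ^ 2 +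
          β ^ 2 * r ^ 2 + 2 * α * β * (r ^ 3 * (su2Quat g).re) + α ^ 2 * (r ^ 4 * (su2Quat g).re ^ 2)) ∂haarProbability (Matrix.specialUnitaryGroup (Fin 2) ℂ) := by
    intro r
    have hpt : ∀ g : Matrix.specialUnitaryGroup (Fin 2) ℂ, Real.exp (κ * r * (su2Quat g).re) *
        ‖(d' + (q : ℍ)) + (α * (r * (su2Quat g).re) + β) • (r • su2Quat g)‖ ^ 2 =
      Real.exp (κ * r * (su2Quat g).re) * ((‖d'‖ ^ 2 + q ^ 2) + 2 * q * β * (r * (su2Quat g).re) + 2 * q * α * (r * (su2Quat g).re) ^ 2 +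
          β ^ 2 * r ^ 2 + 2 * α * β * (r ^ 3 * (su2Quat g).re) + α ^ 2 * (r ^ 4 * (su2Quat g).re ^ 2)) +
      ⟪d', su2Quat g⟫ * (2 * ((α * (r * (su2Quat g).re) + β) * r) * Real.exp (κ * r * (su2Quat g).re)) := by
      intro g
      rw [smul_smul, norm_sq_affine d' hd' q _ _ (norm_su2Quat g)]
      ring
    simp only [hpt]
    rw [integral_add (integrable_of_continuous_SUN (by fun_prop) _) (integrable_of_continuous_SUN (by fun_prop) _),
      integral_inner_mul_eq_zero hd' (fun t => 2 * ((α * (r * t) + β) * r) * Real.exp (κ * r * t)), add_zero]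
  rw [← h]
  refine intervalIntegral.integral_congr fun r _ => ?_
  rw [inner r]

/-- Nonnegativity of a ball integral of a nonnegative integrand (bookkeeping). [folklore] -/
theorem ball_integral_nonneg {F : ℝ → Matrix.specialUnitaryGroup (Fin 2) ℂ → ℝ} (hF : ∀ r g, 0 ≤ F r g) (a : ℕ) :
    0 ≤ ∫ r in (0:ℝ)..1, r ^ a * ∫ g, F r g ∂haarProbability (Matrix.specialUnitaryGroup (Fin 2) ℂ) :=
  intervalIntegral.integral_nonneg zero_le_one fun r hr => mul_nonneg (pow_nonneg hr.1 a) (integral_nonneg fun g => hF r g)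

end Summit.QuantumFields.BalabanUV.InfraRed.StrongCouplingFluxMoments
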